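import Literature.NumberTheory.Transcendental.L2HodgeTheoryGreenCounterexample
import HarnessLib

/-!
# Four more `L²`-Hodge facts of `L2HodgeTheory.lean` fail on the interval `[0,1]`

Sequel to `L2HodgeTheoryGreenCounterexample.lean` (the model with corners `𝓙 : [0,1] → ℝ`, flat
metric `GreenCounterexample.bundle`, standard orientation `GreenCounterexample.orient`, the
calculus `Δη = -(fn η)″`, `⟪β, η⟫ = K ∫₀¹ fn β · fn η`). Like `existsUnique_greenOperator`, every
named fact of `section Closed` of `Literature/NumberTheory/Transcendental/L2HodgeTheory.lean` is a
`def … : Prop` that does **not** bind the unused section instances `[CompactSpace M]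
[I.Boundaryless] [IsContinuousRiemannianBundle …] [IsContMDiffRiemannianBundle …]` (Warner's
standing hypotheses, GTM 94, Ch. 6, p. 220: "compact oriented Riemannian manifold", no boundary),
and so quantifies over manifolds with boundary. This file refutes, on the compact manifold with
boundary `[0,1]` (constant metric, `n = 1`), four of those whose printed proofs use Stokes'
theorem `∫_M d(α ∧ ⋆β) = 0` — i.e. exactly ones a boundary term breaks (the fifth,
`l2Inner_hodgeLaplacian_comm`, is refuted on the flat line in
`L2HodgeTheoryLaplacianCounterexample.lean`; on `[0,1]` one has likewise `⟪Δ t², 1⟫ = -2K ≠ 0 =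
⟪t², Δ 1⟫`):

* `MForm.l2Inner_mextDeriv_left` (`⟪dα, β⟫ = ⟪α, δβ⟫`, Warner Prop. 6.2): `α = t`, `β = dt` give
  `⟪dt, dt⟫ = K` but `⟪t, δ dt⟫ = ⟪t, 0⟫ = 0` (`not_forall_l2Inner_mextDeriv_left`);
* `l2Inner_hodgeLaplacian_self_nonneg` (`0 ≤ ⟪Δα, α⟫`, Prop. 6.2): `⟪Δ t², t²⟫ = -2K/3 < 0`
  (`not_forall_l2Inner_hodgeLaplacian_self_nonneg`);
* `isL2Orthogonal_harmonicForms_exactSmoothForms` (`Hᵏ ⟂ dE^{k-1}`, Thm. 6.8) in degree `k = 1`: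
  `dt = d(t)` is exact *and* harmonic, `⟪dt, dt⟫ = K ≠ 0`
  (`not_forall_isL2Orthogonal_harmonicForms_exactSmoothForms`);
* `isL2Orthogonal_harmonicForms_coexact` (`Hᵏ ⟂ δE^{k+1}`, Thm. 6.8) in degree `k = 0`:
  `1 = δ(-t dt)` is co-exact *and* harmonic, `⟪1, 1⟫ = K ≠ 0`
  (`not_forall_isL2Orthogonal_harmonicForms_coexact`).

Here `K = |e 0| · (e.addHaar / volume) > 0` (`K_pos`, `e = modelBasis ℝ 1`) is the normalising
constant of `∫_{[0,1]}`. The remaining facts of that section (`l2Inner_add_left`,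
`l2Inner_self_eq_zero_iff`, `hodgeStar_mem_harmonicForms`, `finrank_harmonicForms_eq`,
`isL2Orthogonal_exact_coexact`) happen to hold on `[0,1]` and are not addressed here
(`l2Inner_self_eq_zero_iff` and `hodgeStar_mem_harmonicForms` are refuted elsewhere:
`L2HodgeTheoryCounterexample.lean`, `L2HodgeTheoryStarHarmonicProofs.lean`). The intended (closed-manifold) statements are Warner
(1983), Prop. 6.2 and Thm. 6.8, proved under the intended instances in the sibling files
`L2HodgeTheoryAdjointFact.lean`, `L2HodgeTheoryLaplacianNonnegProofs.lean`,
`L2HodgeTheoryHarmonicExactProofs.lean`; this file, like its prequel, is expected to stop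
elaborating and be retired once the facts of `L2HodgeTheory.lean` bind their hypotheses.

## References

* F. W. Warner, *Foundations of Differentiable Manifolds and Lie Groups*, GTM 94, Springer (1983),
  Ch. 6: standing hypothesis p. 220, Prop. 6.2 (p. 221), Thm. 6.8 (p. 223).

## Verdict clean-up note (2026-08-15)

The named facts `MForm.l2Inner_mextDeriv_left`, `isL2Orthogonal_harmonicForms_coexact`,
`isL2Orthogonal_harmonicForms_exactSmoothForms`, `l2Inner_hodgeLaplacian_self_nonneg` are now
`@[deprecated]` records of `L2HodgeTheory.lean` (mis-stated, resp. refuted as stated: a `def` does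
not abstract the unused section instances it was written under; the corrected statements are the
ones proved or named in this file and in the records' docstrings). The declarations
`not_l2Inner_hodgeLaplacian_self_nonneg_unitInterval`,
`not_isL2Orthogonal_harmonicForms_exactSmoothForms_unitInterval`,
`not_l2Inner_mextDeriv_left_unitInterval`, `not_isL2Orthogonal_harmonicForms_coexact_unitInterval`,
`not_forall_l2Inner_hodgeLaplacian_self_nonneg`,
`not_forall_isL2Orthogonal_harmonicForms_exactSmoothForms`, `not_forall_l2Inner_mextDeriv_left`,
`not_forall_isL2Orthogonal_harmonicForms_coexact` name the records on purpose, so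
`linter.deprecated` is silenced on exactly those declarations (REMOVE-WHEN the records are deleted
from `L2HodgeTheory.lean`).
-/

noncomputable section

open scoped Manifold ContDiff Topology
open Set Module MeasureTheory ContinuousAlternatingMap
open Literature.Geometry.Kaehler

namespace Literature.NumberTheory.Transcendental

namespace GreenCounterexample

section WithMetric

open Bundle

attribute [local instance] bundle factFinrank

/-! ### `K > 0` -/

/-- The normalising constant of `∫_{[0,1]}` is positive: `K = |e 0| · (e.addHaar / volume)`. [folklore] -/
theorem K_pos : 0 < K := by
  rw [K, real_sign_mul_self]
  exact mul_pos (abs_pos.2 ((modelBasis ℝ 1).ne_zero 0))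
    (NNReal.coe_pos.2 (Measure.addHaarScalarFactor_pos_of_isAddHaarMeasure _ _))

/-! ### The `L²` product of `1`-forms `f dt`, `g dt` -/

/-- The pointwise inner product of `f dt` and `g dt` is `fg` (`‖dt‖ = 1`). [folklore] -/
theorem inner_of (f g : ℝ → ℝ) (x : unitInterval) :
    MForm.inner 1 (of f) (of g) x = f x.val * g x.val := by
  rw [MForm.inner, alternatingFormInner_apply]
  have hb : ∀ s : Set.powersetCard (Fin 1) 1,
      of f x ((stdOrthonormalBasisFin (TangentSpace 𝓙 x) 1).multiIndex s) *
        of g x ((stdOrthonormalBasisFin (TangentSpace 𝓙 x) 1).multiIndex s) = f x.val * g x.val := by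
    intro s
    rw [of_apply, of_apply]
    set v := (stdOrthonormalBasisFin (TangentSpace 𝓙 x) 1).multiIndex s
    have h1 : @HMul.hMul ℝ ℝ ℝ instHMul (v 0) (v 0) = 1 := by
      rw [← inner_eq]
      have h2 := orthonormal_iff_ite.1 (stdOrthonormalBasisFin (TangentSpace 𝓙 x) 1).orthonormal
        (Set.powersetCard.ofFinEmbEquiv.symm s 0) (Set.powersetCard.ofFinEmbEquiv.symm s 0)
      rw [if_pos rfl] at h2
      exact h2
    linear_combination (f x.val * g x.val) * h1
  rw [Finset.sum_congr rfl fun s _ ↦ hb s, Finset.sum_const, Finset.card_univ,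
    HodgeStarAux.card_powersetCard_fin_self, one_smul]

/-- The integrand of `⟪f dt, g dt⟫_{L²}` is `(fg) dt`. [folklore] -/
theorem inner_of_smul_riemannianVolumeForm_eq_of (f g : ℝ → ℝ) :
    (fun x ↦ MForm.inner 1 (of f) (of g) x • riemannianVolumeForm orient x) =
      of (fun t ↦ f t * g t) := by
  funext x
  rw [inner_of]
  rfl

/-- **`⟪f dt, g dt⟫_{L²} = K ∫₀¹ fg`** for `f`, `g` smooth on `[0,1]`. [folklore] -/
theorem l2Inner_of {f g : ℝ → ℝ} (hf : ContDiffOn ℝ ∞ f (Icc 0 1)) (hg : ContDiffOn ℝ ∞ g (Icc 0 1)) :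
    MForm.l2Inner orient (of f) (of g) = K * ∫ t in (0 : ℝ)..1, f t * g t := by
  rw [MForm.l2Inner, inner_of_smul_riemannianVolumeForm_eq_of, integral_of (hf.mul hg)]

/-- `f dt` only depends on `f` restricted to `[0,1]`. [folklore] -/
theorem of_congr {f g : ℝ → ℝ} (h : EqOn f g (Icc 0 1)) : of f = of g := by
  funext x; refine ContinuousAlternatingMap.ext fun v ↦ ?_
  rw [of_apply, of_apply, h x.2]

/-! ### `δ` and `Δ` on `1`-forms `g dt` -/

/-- **`δ(g dt) = -g′`** on `[0,1]` (`δ = -⋆d⋆` in degree `1`, `n = 1`). [folklore] -/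
theorem mcoderiv_of (h : (0 + 1) + 0 = 1) (g : ℝ → ℝ) :
    mcoderiv orient h (of g) = zf (-(D g)) := by
  rw [mcoderiv, hodgeStar_of, mextDeriv_zeroForm, hodgeStar_of, zf_congr (D_congr (fn_zf_eqOn g)),
    show ((-1 : ℝ) ^ (1 * 0 + 1)) = -1 by norm_num, ← zf_smul]
  congr 1
  funext y
  simp

/-- **`Δ(g dt) = -g″ dt`** on `[0,1]` (`Δ = dδ` in top degree). [folklore] -/
theorem hodgeLaplacian_of (h : 1 + 0 = 1) (g : ℝ → ℝ) :
    hodgeLaplacian orient 1 0 h (of g) = of (-(D (D g))) := by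
  simp only [hodgeLaplacian]
  rw [mcoderiv_of, mextDeriv_zeroForm]
  refine of_congr fun y hy ↦ ?_
  rw [D_congr (fn_zf_eqOn _) hy]
  exact derivWithin.neg

/-! ### Test forms and their `L²` products -/

/-- `∫₀¹` of a function equal to `F` on `[0,1]`. [folklore] -/
theorem intervalIntegral_congr_Icc {f F : ℝ → ℝ} (h : EqOn f F (Icc 0 1)) :
    ∫ t in (0 : ℝ)..1, f t = ∫ t in (0 : ℝ)..1, F t :=
  intervalIntegral.integral_congr fun t ht ↦ h (by rwa [uIcc_of_le zero_le_one] at ht)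

/-- `⟪1, 1⟫_{L²} = K` for the constant `0`-form `1`. [folklore] -/
theorem l2Inner_one_one :
    MForm.l2Inner orient (zf fun _ ↦ (1 : ℝ)) (zf fun _ ↦ (1 : ℝ)) = K := by
  rw [l2Inner_eq (isSmoothForm_zf contDiffOn_const) (isSmoothForm_zf contDiffOn_const),
    intervalIntegral_congr_Icc (F := fun _ ↦ (1 : ℝ)) fun t ht ↦ by simp only [fn_zf ht, mul_one]]
  simp

/-- `⟪dt, dt⟫_{L²} = K`. [folklore] -/
theorem l2Inner_dt_dt :
    MForm.l2Inner orient (of fun _ ↦ (1 : ℝ)) (of fun _ ↦ (1 : ℝ)) = K := by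
  rw [l2Inner_of contDiffOn_const contDiffOn_const]
  simp

/-- `⟪α, 0⟫_{L²} = 0`. [folklore] -/
theorem l2Inner_zero_right {k : ℕ} (α : MForm 𝓙 unitInterval ℝ k) : MForm.l2Inner orient α 0 = 0 := by
  rw [MForm.l2Inner_symm, ← zero_smul ℝ (0 : MForm 𝓙 unitInterval ℝ k), MForm.l2Inner_smul_left,
    zero_mul]

/-- The smooth `0`-form `t²`. [folklore] -/
theorem isSmoothForm_zf_sq : IsSmoothForm (zf fun t ↦ t ^ 2) :=
  isSmoothForm_zf (contDiff_id.pow 2).contDiffOn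

/-- `D t² = 2t` on `[0,1]`. [folklore] -/
theorem D_sq {y : ℝ} (hy : y ∈ Icc (0 : ℝ) 1) : D (fun t ↦ t ^ 2) y = 2 * y := by
  have h := (hasDerivAt_pow 2 y).hasDerivWithinAt.derivWithin (uniqueDiffOn_Icc_zero_one y hy)
  refine h.trans ?_
  push_cast
  ring

/-- `D (D t²) = 2` on `[0,1]`. [folklore] -/
theorem D_D_sq {y : ℝ} (hy : y ∈ Icc (0 : ℝ) 1) : D (D fun t ↦ t ^ 2) y = 2 := by
  rw [D_congr (f := D fun t ↦ t ^ 2) (g := fun t ↦ 2 * t) (fun z hz ↦ D_sq hz) hy]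
  have h := ((hasDerivAt_id' (x := y)).const_mul 2).hasDerivWithinAt.derivWithin
    (uniqueDiffOn_Icc_zero_one y hy)
  exact h.trans (mul_one 2)

/-- `Δ t² = -2` on `[0,1]`. [folklore] -/
theorem hodgeLaplacian_zf_sq (h : 0 + 1 = 1) :
    hodgeLaplacian orient 0 1 h (zf fun t ↦ t ^ 2) = zf (fun _ ↦ -2) := by
  rw [hodgeLaplacian_zeroForm]
  refine zf_congr fun y hy ↦ ?_
  rw [Pi.neg_apply, D_congr (D_congr (fn_zf_eqOn _)) hy, D_D_sq hy]

/-- `d t = dt`: the exterior derivative of the `0`-form `t` is the `1`-form `dt`. [folklore] -/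
theorem mextDeriv_zf_id : mextDeriv (zf fun t ↦ t) = of fun _ ↦ (1 : ℝ) := by
  rw [mextDeriv_zeroForm]
  refine of_congr fun y hy ↦ ?_
  rw [D_congr (fn_zf_eqOn _) hy]
  exact derivWithin_id' (hxs := uniqueDiffOn_Icc_zero_one y hy)

/-- `δ(dt) = 0`. [folklore] -/
theorem mcoderiv_dt (h : (0 + 1) + 0 = 1) : mcoderiv orient h (of fun _ ↦ (1 : ℝ)) = 0 := by
  rw [mcoderiv_of, D_const, neg_zero]
  funext x
  rfl

/-- `δ(-t dt) = 1`. [folklore] -/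
theorem mcoderiv_of_neg (h : (0 + 1) + 0 = 1) :
    mcoderiv orient h (of fun t ↦ -t) = zf fun _ ↦ (1 : ℝ) := by
  rw [mcoderiv_of]
  refine zf_congr fun y hy ↦ ?_
  rw [Pi.neg_apply]
  have : D (fun t : ℝ ↦ -t) y = -1 := derivWithin_neg (hxs := uniqueDiffOn_Icc_zero_one y hy)
  rw [this, neg_neg]

/-- `dt` is a harmonic `1`-form on `[0,1]` (`Δ(g dt) = -g″ dt` with `g = 1`). [folklore] -/
theorem isHarmonicForm_dt (h : 1 + 0 = 1) : IsHarmonicForm orient h (of fun _ ↦ (1 : ℝ)) := by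
  refine ⟨isSmoothForm_of contDiffOn_const, ?_⟩
  rw [hodgeLaplacian_of, D_const, show D (0 : ℝ → ℝ) = 0 from D_const 0, neg_zero]
  funext x
  refine ContinuousAlternatingMap.ext fun v ↦ ?_
  rw [of_apply]
  simp

/-- `dt` is an exact `1`-form on `[0,1]` (`dt = d t`). [folklore] -/
theorem dt_mem_exactSmoothForms : (of fun _ ↦ (1 : ℝ)) ∈ exactSmoothForms 𝓙 unitInterval ℝ 1 := by
  have hs : IsSmoothForm (zf fun t : ℝ ↦ t) := isSmoothForm_zf (f := fun t ↦ t) contDiff_id.contDiffOn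
  have hmem : mextDeriv (zf fun t : ℝ ↦ t) ∈
      mextDeriv '' (smoothForms 𝓙 unitInterval ℝ 0 : Set (MForm 𝓙 unitInterval ℝ 0)) :=
    Set.mem_image_of_mem mextDeriv hs
  rw [mextDeriv_zf_id] at hmem
  exact Submodule.subset_span hmem

/-! ### The refutations -/

-- names the `@[deprecated]` record `l2Inner_hodgeLaplacian_self_nonneg` on purpose (verdict clean-up 2026-08-15); REMOVE-WHEN the
-- record is deleted from `L2HodgeTheory.lean`
set_option linter.deprecated false in
/-- **`l2Inner_hodgeLaplacian_self_nonneg` is false as stated**: on `[0,1]`,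
`⟪Δ t², t²⟫ = -2K ∫₀¹ t² = -2K/3 < 0`. [folklore] -/
theorem not_l2Inner_hodgeLaplacian_self_nonneg_unitInterval :
    ¬ l2Inner_hodgeLaplacian_self_nonneg (I := 𝓙) (M := unitInterval) (k := 0) (m := 1) orient := by
  intro H
  have h := H isSmoothForm_riemannianVolumeForm (zero_add 1) isSmoothForm_zf_sq
  rw [hodgeLaplacian_zf_sq, l2Inner_eq (isSmoothForm_zf contDiffOn_const) isSmoothForm_zf_sq,
    intervalIntegral_congr_Icc (F := fun t ↦ (-2 : ℝ) * t ^ 2) fun t ht ↦ by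
      simp only [fn_zf ht]] at h
  rw [intervalIntegral.integral_const_mul, integral_pow] at h
  norm_num at h
  linarith [K_pos]

-- names the `@[deprecated]` record `isL2Orthogonal_harmonicForms_exactSmoothForms` on purpose (verdict clean-up 2026-08-15); REMOVE-WHEN the
-- record is deleted from `L2HodgeTheory.lean`
set_option linter.deprecated false in
/-- **`isL2Orthogonal_harmonicForms_exactSmoothForms` is false as stated**: on `[0,1]` the
`1`-form `dt = d t` is both harmonic and exact, and `⟪dt, dt⟫ = K ≠ 0`. [folklore] -/
theorem not_isL2Orthogonal_harmonicForms_exactSmoothForms_unitInterval :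
    ¬ isL2Orthogonal_harmonicForms_exactSmoothForms (I := 𝓙) (M := unitInterval) (k := 1) (m := 0)
      orient := by
  intro H
  have h := H isSmoothForm_riemannianVolumeForm (add_zero 1) _
    (subset_harmonicForms _ _ (isHarmonicForm_dt _)) _ dt_mem_exactSmoothForms
  rw [l2Inner_dt_dt] at h
  exact K_pos.ne' h

-- names the `@[deprecated]` record `MForm.l2Inner_mextDeriv_left` on purpose (verdict clean-up 2026-08-15); REMOVE-WHEN the
-- record is deleted from `L2HodgeTheory.lean`
set_option linter.deprecated false in
/-- **`MForm.l2Inner_mextDeriv_left` is false as stated**: on `[0,1]`, for `α = t` and `β = dt`,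
`⟪dα, β⟫ = ⟪dt, dt⟫ = K ≠ 0 = ⟪t, δ dt⟫` (the boundary term `[αβ]₀¹` of `∫ d(α ∧ ⋆β)`). [folklore] -/
theorem not_l2Inner_mextDeriv_left_unitInterval :
    ¬ MForm.l2Inner_mextDeriv_left (I := 𝓙) (M := unitInterval) (k := 0) (m := 0) orient := by
  intro H
  have h := H isSmoothForm_riemannianVolumeForm (show (0 + 1) + 0 = 1 by norm_num)
    (isSmoothForm_zf (f := fun t ↦ t) contDiff_id.contDiffOn)
    (isSmoothForm_of contDiffOn_const (g := fun _ ↦ (1 : ℝ)))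
  rw [mextDeriv_zf_id, l2Inner_dt_dt, mcoderiv_dt, l2Inner_zero_right] at h
  exact K_pos.ne' h

-- names the `@[deprecated]` record `isL2Orthogonal_harmonicForms_coexact` on purpose (verdict clean-up 2026-08-15); REMOVE-WHEN the
-- record is deleted from `L2HodgeTheory.lean`
set_option linter.deprecated false in
/-- **`isL2Orthogonal_harmonicForms_coexact` is false as stated**: on `[0,1]` the constant
`0`-form `1 = δ(-t dt)` is both harmonic and co-exact, and `⟪1, 1⟫ = K ≠ 0`. [folklore] -/
theorem not_isL2Orthogonal_harmonicForms_coexact_unitInterval :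
    ¬ isL2Orthogonal_harmonicForms_coexact (I := 𝓙) (M := unitInterval) (k := 0) (m := 0) orient := by
  intro H
  have hco : (zf fun _ ↦ (1 : ℝ)) ∈ Submodule.span ℝ (mcoderiv orient (show (0 + 1) + 0 = 1 by norm_num) ''
      (smoothForms 𝓙 unitInterval ℝ (0 + 1) : Set (MForm 𝓙 unitInterval ℝ (0 + 1)))) :=
    Submodule.subset_span ⟨of fun t ↦ -t, isSmoothForm_of (contDiff_neg.contDiffOn), mcoderiv_of_neg _⟩
  have h := H isSmoothForm_riemannianVolumeForm (show 0 + (0 + 1) = 1 by norm_num) _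
    (subset_harmonicForms _ _ (isHarmonicForm_zf_const _ 1)) _ hco
  rw [l2Inner_one_one] at h
  exact K_pos.ne' h

end WithMetric

end GreenCounterexample

section UniversalClosure

attribute [local instance] GreenCounterexample.bundle GreenCounterexample.factFinrank

-- names the `@[deprecated]` record `l2Inner_hodgeLaplacian_self_nonneg` on purpose (verdict clean-up 2026-08-15); REMOVE-WHEN the
-- record is deleted from `L2HodgeTheory.lean`
set_option linter.deprecated false in
/-- **`l2Inner_hodgeLaplacian_self_nonneg` cannot be discharged as stated** (universal closure
false, witness `[0,1]`). [folklore] -/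
theorem not_forall_l2Inner_hodgeLaplacian_self_nonneg :
    ¬ ∀ (M : Type) [TopologicalSpace M] [ChartedSpace unitInterval M] [T2Space M]
        [SigmaCompactSpace M] [CompactSpace M] [IsManifold GreenCounterexample.𝓙 ∞ M]
        [Bundle.RiemannianBundle (fun x : M ↦ TangentSpace GreenCounterexample.𝓙 x)]
        (o : (x : M) → Orientation ℝ (TangentSpace GreenCounterexample.𝓙 x) (Fin 1)),
        l2Inner_hodgeLaplacian_self_nonneg (k := 0) (m := 1) o :=
  fun H ↦ GreenCounterexample.not_l2Inner_hodgeLaplacian_self_nonneg_unitInterval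
    (H unitInterval GreenCounterexample.orient)

-- names the `@[deprecated]` record `isL2Orthogonal_harmonicForms_exactSmoothForms` on purpose (verdict clean-up 2026-08-15); REMOVE-WHEN the
-- record is deleted from `L2HodgeTheory.lean`
set_option linter.deprecated false in
/-- **`isL2Orthogonal_harmonicForms_exactSmoothForms` cannot be discharged as stated**
(universal closure false, witness `[0,1]`). [folklore] -/
theorem not_forall_isL2Orthogonal_harmonicForms_exactSmoothForms :
    ¬ ∀ (M : Type) [TopologicalSpace M] [ChartedSpace unitInterval M] [T2Space M]
        [SigmaCompactSpace M] [CompactSpace M] [IsManifold GreenCounterexample.𝓙 ∞ M]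
        [Bundle.RiemannianBundle (fun x : M ↦ TangentSpace GreenCounterexample.𝓙 x)]
        (o : (x : M) → Orientation ℝ (TangentSpace GreenCounterexample.𝓙 x) (Fin 1)),
        isL2Orthogonal_harmonicForms_exactSmoothForms (k := 1) (m := 0) o :=
  fun H ↦ GreenCounterexample.not_isL2Orthogonal_harmonicForms_exactSmoothForms_unitInterval
    (H unitInterval GreenCounterexample.orient)

-- names the `@[deprecated]` record `MForm.l2Inner_mextDeriv_left` on purpose (verdict clean-up 2026-08-15); REMOVE-WHEN the
-- record is deleted from `L2HodgeTheory.lean`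
set_option linter.deprecated false in
/-- **`MForm.l2Inner_mextDeriv_left` cannot be discharged as stated** (universal closure false,
witness `[0,1]`). [folklore] -/
theorem not_forall_l2Inner_mextDeriv_left :
    ¬ ∀ (M : Type) [TopologicalSpace M] [ChartedSpace unitInterval M] [T2Space M]
        [SigmaCompactSpace M] [CompactSpace M] [IsManifold GreenCounterexample.𝓙 ∞ M]
        [Bundle.RiemannianBundle (fun x : M ↦ TangentSpace GreenCounterexample.𝓙 x)]
        (o : (x : M) → Orientation ℝ (TangentSpace GreenCounterexample.𝓙 x) (Fin 1)),
        MForm.l2Inner_mextDeriv_left (k := 0) (m := 0) o :=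
  fun H ↦ GreenCounterexample.not_l2Inner_mextDeriv_left_unitInterval
    (H unitInterval GreenCounterexample.orient)

-- names the `@[deprecated]` record `isL2Orthogonal_harmonicForms_coexact` on purpose (verdict clean-up 2026-08-15); REMOVE-WHEN the
-- record is deleted from `L2HodgeTheory.lean`
set_option linter.deprecated false in
/-- **`isL2Orthogonal_harmonicForms_coexact` cannot be discharged as stated** (universal closure
false, witness `[0,1]`). [folklore] -/
theorem not_forall_isL2Orthogonal_harmonicForms_coexact :
    ¬ ∀ (M : Type) [TopologicalSpace M] [ChartedSpace unitInterval M] [T2Space M]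
        [SigmaCompactSpace M] [CompactSpace M] [IsManifold GreenCounterexample.𝓙 ∞ M]
        [Bundle.RiemannianBundle (fun x : M ↦ TangentSpace GreenCounterexample.𝓙 x)]
        (o : (x : M) → Orientation ℝ (TangentSpace GreenCounterexample.𝓙 x) (Fin 1)),
        isL2Orthogonal_harmonicForms_coexact (k := 0) (m := 0) o :=
  fun H ↦ GreenCounterexample.not_isL2Orthogonal_harmonicForms_coexact_unitInterval
    (H unitInterval GreenCounterexample.orient)

end UniversalClosure

end Literature.NumberTheory.Transcendental
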